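import Summits.CriticalPhenomena.PercolationContinuityZ3.Theorems.PercNearOneGluingNoHeavyLowerTailSunflowerParityLemma
import HarnessLib
import HarnessLib.Audit

/-!
# `NoHeavyLowerTail` (crux stmt-CriticalPhenomena-4575), abstract sunflower cubic: the THREE-PETAL CUBE GLADKOV INEQUALITY IN
# GF(2)-RANK AND MARRIAGE FORM, part 1/2 — the KEY PARITY IDENTITY `M·N ≡ I`

Support file (seat `prim-l12-p2` gen 18; `--supports stmt-CriticalPhenomena-4575`).  No `sorry`, no new definitions.  Part 2/2
(`…SunflowerCubeGladkovRank`) draws the consequences (full row rank, localised three-petal Gladkov, the marriage form).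
Memo: run/shared/lean/prim/prim-l12/prim-l12-p2/FINDING-g18-CUBE-GLADKOV-RANK.md.

SETTING.  `F : Sunflower α` (three up-sets with common pairwise intersection; labels `lab : 2^α → M₃`, `4` kernel `A`, `0` bottom `B`,
`1,2,3` petals), a cube `W`, complements `τS = W ∖ S` inside `W`.
* `CR(W)` = the cross antipodal pairs of `W`, each listed ONCE by its larger-label side:
  `{Y ⊆ W : lab Y, lab τY petals, lab τY < lab Y}` (all three types `(1|2), (1|3), (2|3)` together);
* `ABbot(W)` = the kernel–bottom antipodal pairs listed by the bottom side: `{O ⊆ W : lab O = 0, lab τO = 4}`.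
Antipodal Gladkov (`Sunflower.card_distinctPetals_le`, prove-1) is the COUNT `#CR(W) ≤ #ABbot(W)`.

THEOREM (this file).  The `CR × ABbot` matrix `M(Y,O) = #{R ∈ B : O ⊆ R ⊆ Y} (mod 2)` has FULL ROW RANK over `GF(2)`
(`Sunflower.cross_kernel_trivial`).  Since `M(Y,O) ≠ 0 ⇒ O ⊆ Y`, consequences:
* `Sunflower.card_cross_filter_le` — LOCALISED three-petal Gladkov: `#(CR ∩ D) ≤ #(ABbot ∩ D)` for every down-set `D`;
* `Sunflower.crossMatching` — MARRIAGE FORM: an injection `φ : CR → ABbot` with `φ Y ⊆ Y` (the bottom side of the image pair sits inside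
  the larger-label petal side, equivalently the kernel side contains the smaller-label petal side) — all three cross types at once.
  The two-petal case is `gladkovMatching` (gen 15, images only kernel–(non-`V₁∪V₂`) pairs); the simultaneous three-type statement with
  images in the `A|B` pairs is new, and is exactly the "spectator part" of the `StarMatching` conjecture (`…SunflowerStarMatching`):
  for a spectator block `S` the demands `(i,S,j)` are the cross pairs of the cube `W ∖ S` and their admissible images with `S` fixed are its
  `A|B` pairs.
ENGINE (`Sunflower.crossKey`).  With `N(O,Y″) = #{R ∈ A : τY″ ⊆ R ⊆ τO}`:  `Σ_O M(Y,O)·N(O,Y″) ≡ [Y = Y″] (mod 2)` whenever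
`lab τY″ ≠ lab Y` — three exchanges of summation, each inner sum being the number of sub/supersets of a fixed set (odd iff trivial).
The excluded case is (row type `(1|2)`, column type `(2|3)`), so `M·N` is unitriangular in the type order `(1|2),(1|3) < (2|3)`, whence the
kernel argument: first the coefficients of rows with `lab τY = 1` vanish, then those of type `(2|3)`.
Census before the proof (this gen, code-g18): full row rank in all 30 738 cubes with cross pairs on ≤ 4 points and 3·10⁵ sampled on 5–6
points; the bare containment matrix `[O ⊆ Y]` is rank-deficient in ≈ 0.3 % of them.
-/

namespace Summit.CriticalPhenomena.PercolationContinuityZ3.Theorems.SunflowerPartition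

open Finset

namespace Sunflower

variable {α : Type*} [DecidableEq α] (F : Sunflower α)

/-! ## Label transport along inclusions (from `lab_mono`) -/

/-- Below a bottom set everything is bottom. [this work] -/
theorem lab_eq_zero_of_subset {S T : Finset α} (hST : S ⊆ T) (hT : F.lab T = 0) : F.lab S = 0 := by
  rcases F.lab_mono hST with h | h | h
  · exact h.trans hT
  · exact h
  · rw [hT] at h; exact absurd h (by decide)

/-- Above a kernel set everything is kernel. [this work] -/
theorem lab_eq_four_of_subset {S T : Finset α} (hST : S ⊆ T) (hS : F.lab S = 4) : F.lab T = 4 := by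
  rcases F.lab_mono hST with h | h | h
  · exact h.symm.trans hS |>.symm ▸ (h ▸ hS) |> fun _ => by rw [← h, hS]
  · rw [hS] at h; exact absurd h (by decide)
  · exact h

/-- Above a non-bottom set `S`, every set has label `lab S` or `4`. [this work] -/
theorem lab_superset {S T : Finset α} (hST : S ⊆ T) (hS : F.lab S ≠ 0) : F.lab T = F.lab S ∨ F.lab T = 4 := by
  rcases F.lab_mono hST with h | h | h
  · exact Or.inl h.symm
  · exact absurd h hS
  · exact Or.inr h

/-- Below a non-kernel set `T`, every set has label `lab T` or `0`. [this work] -/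
theorem lab_subset {S T : Finset α} (hST : S ⊆ T) (hT : F.lab T ≠ 4) : F.lab S = F.lab T ∨ F.lab S = 0 := by
  rcases F.lab_mono hST with h | h | h
  · exact Or.inl h
  · exact Or.inr h
  · exact absurd h hT

/-! ## The key parity identity `M·N ≡ I` off the block `(1|2) × (2|3)` -/

/-- **KEY IDENTITY** (this work).  For `Y, Y″ ⊆ W` with `lab Y ≠ 4`, `lab τY ≠ 4`, `lab Y″ ≠ 0`, `lab τY″ ∉ {0,4}` and
`lab τY″ ≠ lab Y` (`τ = W ∖ ·`):
`Σ_{O ⊆ W} #{R' ∈ B : O ⊆ R' ⊆ Y} · #{R ∈ A : τY″ ⊆ R ⊆ τO} ≡ [Y = Y″] (mod 2)`. [this work] -/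
theorem crossKey (W : Finset α) {Y Y'' : Finset α} (hY : Y ⊆ W) (hY'' : Y'' ⊆ W)
    (hY4 : F.lab Y ≠ 4) (hcY4 : F.lab (W \ Y) ≠ 4) (hY''0 : F.lab Y'' ≠ 0)
    (hc0 : F.lab (W \ Y'') ≠ 0) (hc4 : F.lab (W \ Y'') ≠ 4) (hne : F.lab (W \ Y'') ≠ F.lab Y) :
    (∑ O ∈ W.powerset,
        (∑ R' ∈ W.powerset, (if F.lab R' = 0 ∧ O ⊆ R' ∧ R' ⊆ Y then (1 : ZMod 2) else 0)) *
        (∑ R ∈ W.powerset, (if F.lab R = 4 ∧ W \ Y'' ⊆ R ∧ R ⊆ W \ O then (1 : ZMod 2) else 0)))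
      = if Y = Y'' then 1 else 0 := by
  -- (b) expand and do the `O`-sum first: `#{O ⊆ R' ∖ R} ≡ [R' ⊆ R]`
  have hO : ∀ R' ∈ W.powerset, ∀ R ∈ W.powerset,
      (∑ O ∈ W.powerset, ((if F.lab R' = 0 ∧ O ⊆ R' ∧ R' ⊆ Y then (1 : ZMod 2) else 0) *
        (if F.lab R = 4 ∧ W \ Y'' ⊆ R ∧ R ⊆ W \ O then (1 : ZMod 2) else 0)))
        = if F.lab R' = 0 ∧ R' ⊆ Y ∧ F.lab R = 4 ∧ W \ Y'' ⊆ R ∧ R' ⊆ R then 1 else 0 := by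
    intro R' hR' R hR
    have hR'W : R' ⊆ W := mem_powerset.1 hR'
    have hRW : R ⊆ W := mem_powerset.1 hR
    by_cases h1 : F.lab R' = 0 ∧ R' ⊆ Y ∧ F.lab R = 4 ∧ W \ Y'' ⊆ R
    · rw [show (if F.lab R' = 0 ∧ R' ⊆ Y ∧ F.lab R = 4 ∧ W \ Y'' ⊆ R ∧ R' ⊆ R then (1 : ZMod 2) else 0)
          = if (∅ : Finset α) = R' \ R then 1 else 0 by
        by_cases h2 : R' ⊆ R
        · rw [if_pos ⟨h1.1, h1.2.1, h1.2.2.1, h1.2.2.2, h2⟩, if_pos (Finset.sdiff_eq_empty_iff_subset.2 h2).symm]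
        · rw [if_neg fun h => h2 h.2.2.2.2, if_neg fun h => h2 (Finset.sdiff_eq_empty_iff_subset.1 h.symm)]]
      rw [← HallGladkov.sum_powerset_ite_Icc (A := ∅) (B := R' \ R) (W := W) (sdiff_subset.trans hR'W)]
      refine sum_congr rfl fun O hO => ?_
      have hOW : O ⊆ W := mem_powerset.1 hO
      simp only [ite_zero_mul_ite_zero, one_mul]
      by_cases h3 : O ⊆ R' \ R
      · rw [if_pos (show (∅ : Finset α) ⊆ O ∧ O ⊆ R' \ R from ⟨empty_subset _, h3⟩),
          if_pos (show (F.lab R' = 0 ∧ O ⊆ R' ∧ R' ⊆ Y) ∧ F.lab R = 4 ∧ W \ Y'' ⊆ R ∧ R ⊆ W \ O from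
            ⟨⟨h1.1, h3.trans sdiff_subset, h1.2.1⟩, h1.2.2.1, h1.2.2.2,
              fun x hx => mem_sdiff.2 ⟨hRW hx, fun hxO => (mem_sdiff.1 (h3 hxO)).2 hx⟩⟩)]
      · rw [if_neg (show ¬ ((∅ : Finset α) ⊆ O ∧ O ⊆ R' \ R) from fun h => h3 h.2),
          if_neg (show ¬ ((F.lab R' = 0 ∧ O ⊆ R' ∧ R' ⊆ Y) ∧ F.lab R = 4 ∧ W \ Y'' ⊆ R ∧ R ⊆ W \ O) from
            fun h => h3 fun x hx => mem_sdiff.2 ⟨h.1.2.1 hx, fun hxR => (mem_sdiff.1 (h.2.2.2 hxR)).2 hx⟩)]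
    · rw [if_neg fun h => h1 ⟨h.1, h.2.1, h.2.2.1, h.2.2.2.1⟩]
      refine sum_eq_zero fun O _ => ?_
      rw [ite_zero_mul_ite_zero, if_neg]
      rintro ⟨⟨h0, -, hY'⟩, h4, hs, -⟩
      exact h1 ⟨h0, hY', h4, hs⟩
  rw [show (∑ O ∈ W.powerset,
        (∑ R' ∈ W.powerset, (if F.lab R' = 0 ∧ O ⊆ R' ∧ R' ⊆ Y then (1 : ZMod 2) else 0)) *
        (∑ R ∈ W.powerset, (if F.lab R = 4 ∧ W \ Y'' ⊆ R ∧ R ⊆ W \ O then (1 : ZMod 2) else 0)))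
      = ∑ R' ∈ W.powerset, ∑ R ∈ W.powerset,
          (if F.lab R' = 0 ∧ R' ⊆ Y ∧ F.lab R = 4 ∧ W \ Y'' ⊆ R ∧ R' ⊆ R then (1 : ZMod 2) else 0) by
    rw [show (∑ O ∈ W.powerset,
        (∑ R' ∈ W.powerset, (if F.lab R' = 0 ∧ O ⊆ R' ∧ R' ⊆ Y then (1 : ZMod 2) else 0)) *
        (∑ R ∈ W.powerset, (if F.lab R = 4 ∧ W \ Y'' ⊆ R ∧ R ⊆ W \ O then (1 : ZMod 2) else 0)))
      = ∑ O ∈ W.powerset, ∑ R' ∈ W.powerset, ∑ R ∈ W.powerset,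
          ((if F.lab R' = 0 ∧ O ⊆ R' ∧ R' ⊆ Y then (1 : ZMod 2) else 0) *
           (if F.lab R = 4 ∧ W \ Y'' ⊆ R ∧ R ⊆ W \ O then (1 : ZMod 2) else 0)) from
      sum_congr rfl fun O _ => Finset.sum_mul_sum _ _ _ _]
    rw [Finset.sum_comm]
    refine sum_congr rfl fun R' hR' => ?_
    rw [Finset.sum_comm]
    exact sum_congr rfl fun R hR => hO R' hR' R hR]
  -- (c) the `R`-sum: kernel supersets of `τY″ ∪ R'` ≡ label-`i″` supersets (their total is even, `τY″ ∪ R' ≠ W`)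
  have hc : ∀ R' ∈ W.powerset, F.lab R' = 0 →
      (∑ R ∈ W.powerset, (if F.lab R = 4 ∧ W \ Y'' ⊆ R ∧ R' ⊆ R then (1 : ZMod 2) else 0))
        = ∑ S ∈ W.powerset, (if F.lab S = F.lab (W \ Y'') ∧ W \ Y'' ⊆ S ∧ R' ⊆ S then (1 : ZMod 2) else 0) := by
    intro R' hR' h0
    have hR'W : R' ⊆ W := mem_powerset.1 hR'
    -- total number of supersets of `(W ∖ Y″) ∪ R'` is even
    have htot : (∑ R ∈ W.powerset, (if (W \ Y'') ∪ R' ⊆ R then (1 : ZMod 2) else 0)) = 0 := by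
      rw [HallGladkov.sum_powerset_ite_superset, if_neg]
      intro hW
      -- then `Y″ ⊆ R'`, so `lab Y″ = 0`
      have hsub : Y'' ⊆ R' := by
        intro x hx
        have hxW : x ∈ (W \ Y'') ∪ R' := hW.symm ▸ hY'' hx
        rcases mem_union.1 hxW with h | h
        · exact absurd hx (mem_sdiff.1 h).2
        · exact h
      exact hY''0 (F.lab_eq_zero_of_subset hsub h0)
    -- split the total by the label of `R` (only `i″` and `4` occur)
    have hsplit : ∀ R ∈ W.powerset, (if (W \ Y'') ∪ R' ⊆ R then (1 : ZMod 2) else 0)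
        = (if F.lab R = 4 ∧ W \ Y'' ⊆ R ∧ R' ⊆ R then (1 : ZMod 2) else 0)
          + (if F.lab R = F.lab (W \ Y'') ∧ W \ Y'' ⊆ R ∧ R' ⊆ R then (1 : ZMod 2) else 0) := by
      intro R _
      by_cases h : (W \ Y'') ∪ R' ⊆ R
      · have h1 : W \ Y'' ⊆ R := subset_union_left.trans h
        have h2 : R' ⊆ R := subset_union_right.trans h
        rw [if_pos h]
        rcases F.lab_superset h1 hc0 with hl | hl
        · rw [if_neg fun h' => hc4 (hl.symm.trans h'.1), if_pos ⟨hl, h1, h2⟩, zero_add]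
        · rw [if_pos ⟨hl, h1, h2⟩, if_neg fun h' => hc4 (h'.1.symm.trans hl), add_zero]
      · rw [if_neg h, if_neg fun h' => h (union_subset h'.2.1 h'.2.2), if_neg fun h' => h (union_subset h'.2.1 h'.2.2),
          add_zero]
    rw [sum_congr rfl hsplit, sum_add_distrib] at htot
    -- in `ZMod 2`, `x + y = 0 → x = y`
    have key := eq_neg_of_add_eq_zero_left htot
    rw [key, ZMod.neg_eq_self_mod_two]
  rw [show (∑ R' ∈ W.powerset, ∑ R ∈ W.powerset,
          (if F.lab R' = 0 ∧ R' ⊆ Y ∧ F.lab R = 4 ∧ W \ Y'' ⊆ R ∧ R' ⊆ R then (1 : ZMod 2) else 0))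
      = ∑ R' ∈ W.powerset, ∑ S ∈ W.powerset,
          (if F.lab R' = 0 ∧ R' ⊆ Y ∧ F.lab S = F.lab (W \ Y'') ∧ W \ Y'' ⊆ S ∧ R' ⊆ S then (1 : ZMod 2) else 0) by
    refine sum_congr rfl fun R' hR' => ?_
    by_cases h0 : F.lab R' = 0 ∧ R' ⊆ Y
    · have := hc R' hR' h0.1
      rw [show (∑ R ∈ W.powerset, (if F.lab R' = 0 ∧ R' ⊆ Y ∧ F.lab R = 4 ∧ W \ Y'' ⊆ R ∧ R' ⊆ R then (1 : ZMod 2) else 0))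
          = ∑ R ∈ W.powerset, (if F.lab R = 4 ∧ W \ Y'' ⊆ R ∧ R' ⊆ R then (1 : ZMod 2) else 0) from
        sum_congr rfl fun R _ => by simp only [h0, true_and],
        this]
      exact sum_congr rfl fun S _ => by simp only [h0, true_and]
    · rw [sum_congr rfl fun R _ => if_neg fun h => h0 ⟨h.1, h.2.1⟩,
        sum_congr rfl fun S _ => if_neg fun h => h0 ⟨h.1, h.2.1⟩]]
  -- (d) exchange: the `R'`-sum counts the subsets of `Y ∩ S` (all bottom, as `lab S = i″ ≠ lab Y`), odd iff `Y ∩ S = ∅`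
  rw [Finset.sum_comm]
  have hd : ∀ S ∈ W.powerset,
      (∑ R' ∈ W.powerset, (if F.lab R' = 0 ∧ R' ⊆ Y ∧ F.lab S = F.lab (W \ Y'') ∧ W \ Y'' ⊆ S ∧ R' ⊆ S then (1 : ZMod 2) else 0))
        = if F.lab S = F.lab (W \ Y'') ∧ W \ Y'' ⊆ S ∧ S ⊆ W \ Y then 1 else 0 := by
    intro S hS
    have hSW : S ⊆ W := mem_powerset.1 hS
    by_cases h1 : F.lab S = F.lab (W \ Y'') ∧ W \ Y'' ⊆ S
    · rw [show (if F.lab S = F.lab (W \ Y'') ∧ W \ Y'' ⊆ S ∧ S ⊆ W \ Y then (1 : ZMod 2) else 0)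
          = if (∅ : Finset α) = Y ∩ S then 1 else 0 by
        by_cases h2 : S ⊆ W \ Y
        · rw [if_pos ⟨h1.1, h1.2, h2⟩, if_pos]
          refine (Finset.eq_empty_iff_forall_notMem.2 fun x hx => ?_).symm
          exact (mem_sdiff.1 (h2 (mem_inter.1 hx).2)).2 (mem_inter.1 hx).1
        · rw [if_neg fun h => h2 h.2.2, if_neg]
          intro he
          exact h2 fun x hx => mem_sdiff.2 ⟨hSW hx, fun hxY => (Finset.notMem_empty x) (he.symm ▸ mem_inter.2 ⟨hxY, hx⟩)⟩]
      rw [← HallGladkov.sum_powerset_ite_Icc (A := ∅) (B := Y ∩ S) (W := W) (inter_subset_left.trans hY)]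
      refine sum_congr rfl fun R' _ => ?_
      by_cases h3 : R' ⊆ Y ∩ S
      · have hR'Y : R' ⊆ Y := h3.trans inter_subset_left
        have hR'S : R' ⊆ S := h3.trans inter_subset_right
        -- `lab R' = 0`: it is `lab Y` or `0`, and `lab S = i″` or `0`, and `i″ ≠ lab Y`
        have hl0 : F.lab R' = 0 := by
          rcases F.lab_subset hR'Y hY4 with hRY | hR0
          · rcases F.lab_subset hR'S (fun h4 => hc4 (h1.1 ▸ h4)) with hRS | hR0
            · exact absurd (hRY.symm.trans (hRS.trans h1.1)) hne.symm
            · exact hR0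
          · exact hR0
        rw [if_pos ⟨hl0, hR'Y, h1.1, h1.2, hR'S⟩, if_pos ⟨empty_subset _, h3⟩]
      · rw [if_neg fun h => h3 (subset_inter h.2.1 h.2.2.2.2), if_neg fun h => h3 h.2]
    · rw [if_neg fun h => h1 ⟨h.1, h.2.1⟩]
      exact sum_eq_zero fun R' _ => if_neg fun h => h1 ⟨h.2.2.1, h.2.2.2.1⟩
  rw [sum_congr rfl hd]
  -- (e) the interval `[τY″, τY]` consists of label-`i″` sets, so the count is `[τY″ = τY] = [Y = Y″]`
  rw [show (if Y = Y'' then (1 : ZMod 2) else 0) = if W \ Y'' = W \ Y then 1 else 0 by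
    by_cases h : Y = Y''
    · rw [if_pos h, if_pos (h ▸ rfl)]
    · rw [if_neg h, if_neg]
      intro h'
      exact h (by rw [← Finset.sdiff_sdiff_eq_self hY, ← h', Finset.sdiff_sdiff_eq_self hY''])]
  rw [← HallGladkov.sum_powerset_ite_Icc (A := W \ Y'') (B := W \ Y) (W := W) sdiff_subset]
  refine sum_congr rfl fun S _ => ?_
  by_cases h : W \ Y'' ⊆ S ∧ S ⊆ W \ Y
  · have hl : F.lab S = F.lab (W \ Y'') := by
      rcases F.lab_superset h.1 hc0 with h1 | h1
      · exact h1
      · exact absurd (F.lab_eq_four_of_subset h.2 h1) hcY4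
    rw [if_pos ⟨hl, h.1, h.2⟩, if_pos h]
  · rw [if_neg fun h' => h ⟨h'.2.1, h'.2.2⟩, if_neg h]

end Sunflower

end Summit.CriticalPhenomena.PercolationContinuityZ3.Theorems.SunflowerPartition
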